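import Literature.NumberTheory.DiophantineGeometry.SophieGermainFirstCase
import Mathlib.Tactic
import HarnessLib

/-!
# Legendre's extension of Sophie Germain's theorem (FLT I when `kp + 1` is prime, `k ∈ {4, 8, 10, 14, 16}`)

P. Ribenboim, *Fermat's Last Theorem for Amateurs* (1999) [Ribenboim1999FLTAmateurs], Ch. IV, §1,
(1E) (Legendre, 1823): *if `p > 3` is prime and one of `4p + 1`, `8p + 1`, `10p + 1`, `14p + 1`,
`16p + 1` is also prime, then the first case of Fermat's Last Theorem holds for the exponent `p`.*
Everything here is a `theorem` (no named facts).

## The printed proof and this file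

Ribenboim verifies, case by case, the two hypotheses of Sophie Germain's theorem in Wendt's form
((1B): no two consecutive `k`-th roots of unity modulo `q = kp + 1`, and `k^k ≢ 1 (mod q)`, the
latter being "condition (2′)"), working with explicit primitive roots of unity "apart from trivial
cases". We discharge exactly these two hypotheses of the tree's `wendt_firstCase`
(`SophieGermainFirstCase.lean`, Cohen Prop. 6.9.6 in root form) uniformly: for each `k` an explicit
polynomial certificate `A_k(X)(X^k − 1) + B_k(X)((X + 1)^k − 1) = R_k` (the reduced resultant;
`R_4 = 15`, `R_8 = 255`, `R_10 = 1023`, `R_14 = 3800856`, `R_16 = 458745`), checked by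
`linear_combination`, shows that a common root forces `q ∣ R_k`; and `k^k ≡ 1` forces `q ∣ k^k − 1`.
The prime factorizations of `R_k` and `k^k − 1` contain no prime of the form `kp + 1` with `p > 3`
prime (the excluded `p = 2, 3` do occur: `17 = 8·2 + 1`, `31 = 10·3 + 1`, `29 = 14·2 + 1`,
`43 = 14·3 + 1`), which is where the hypothesis `p > 3` of (1E) is used.

Search: `lean search 'Legendre.*first|14 \* p \+ 1|16 \* p \+ 1'` — nothing beyond
`SophieGermainFirstCase.lean` (`sophieGermain_firstCase`, `wendt_firstCase`, the tables for `p < 200`).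
-/

namespace Literature.NumberTheory.DiophantineGeometry

namespace Legendre

/-- `4p + 1 ∤ 15` for a prime `p > 3` with `4p + 1` prime (`15 = 3·5`). [cite: Ribenboim1999FLTAmateurs, Ch. IV (1E) (proof)] -/
theorem not_dvd_res_4 {p : ℕ} (hp : p.Prime) (h3 : 3 < p) (hq : (4 * p + 1).Prime) :
    ¬ 4 * p + 1 ∣ 15 := by
  intro hd
  have h5 : 5 ≤ p := by
    rcases Nat.lt_or_ge p 5 with hlt | hge
    · interval_cases p; exact absurd hp (by norm_num)
    · exact hge
  have h0 : 4 * p + 1 ∣ 3 * (5) := by norm_num; exact hd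
  rcases (Nat.Prime.dvd_mul hq).mp h0 with h | h0
  · have := Nat.le_of_dvd (by norm_num) h
    omega
  have h := h0
  have := Nat.le_of_dvd (by norm_num) h
  omega

/-- `4p + 1 ∤ 255` for a prime `p > 3` with `4p + 1` prime (`255 = 3·5·17`). [cite: Ribenboim1999FLTAmateurs, Ch. IV (1E) (proof)] -/
theorem not_dvd_powself_4 {p : ℕ} (hp : p.Prime) (h3 : 3 < p) (hq : (4 * p + 1).Prime) :
    ¬ 4 * p + 1 ∣ 255 := by
  intro hd
  have h5 : 5 ≤ p := by
    rcases Nat.lt_or_ge p 5 with hlt | hge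
    · interval_cases p; exact absurd hp (by norm_num)
    · exact hge
  have h0 : 4 * p + 1 ∣ 3 * (5 * (17)) := by norm_num; exact hd
  rcases (Nat.Prime.dvd_mul hq).mp h0 with h | h0
  · have := Nat.le_of_dvd (by norm_num) h
    omega
  rcases (Nat.Prime.dvd_mul hq).mp h0 with h | h0
  · have := Nat.le_of_dvd (by norm_num) h
    omega
  have h := h0
  have := Nat.le_of_dvd (by norm_num) h
  omega

/-- **Legendre (1823), the case `q = 4p + 1`:** if `p > 3` and `4p + 1` are prime, the first case
of FLT holds for `p` — Wendt's criterion with `k = 4`: the resultant certificate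
`A·(X^4 − 1) + B·((X+1)^4 − 1) = 15` and `4^4 − 1 = 255` have no prime factor of the form
`4p + 1`, `p > 3` prime. [cite: Ribenboim1999FLTAmateurs, Ch. IV (1E)] -/
theorem firstCase_of_prime_4p1 {p : ℕ} (hp : p.Prime) (h3 : 3 < p) (hq : (4 * p + 1).Prime)
    {x y z : ℤ} (h : x ^ p + y ^ p + z ^ p = 0) : (p : ℤ) ∣ x * y * z := by
  refine wendt_firstCase (k := 4) hp (by omega) hq ?_ ?_ h
  · intro u h1 h2
    have hR : ((15 : ℕ) : ZMod (4 * p + 1)) = 0 := by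
      have e : (15 : ZMod (4 * p + 1)) = 0 := by
        linear_combination ((-15) + (-20) * u + (-14) * u ^ 2 + (-4) * u ^ 3) * h1 + ((-5) + (4) * u + (-2) * u ^ 2 + (4) * u ^ 3) * h2
      exact_mod_cast e
    rw [ZMod.natCast_eq_zero_iff] at hR
    exact not_dvd_res_4 hp h3 hq hR
  · intro hk1
    push_cast at hk1
    have hK : ((255 : ℕ) : ZMod (4 * p + 1)) = 0 := by
      have e : ((255 : ℕ) : ZMod (4 * p + 1)) = (4 : ZMod (4 * p + 1)) ^ 4 - 1 := by
        push_cast; ring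
      rw [e, hk1, sub_self]
    rw [ZMod.natCast_eq_zero_iff] at hK
    exact not_dvd_powself_4 hp h3 hq hK

/-- `8p + 1 ∤ 255` for a prime `p > 3` with `8p + 1` prime (`255 = 3·5·17`). [cite: Ribenboim1999FLTAmateurs, Ch. IV (1E) (proof)] -/
theorem not_dvd_res_8 {p : ℕ} (hp : p.Prime) (h3 : 3 < p) (hq : (8 * p + 1).Prime) :
    ¬ 8 * p + 1 ∣ 255 := by
  intro hd
  have h5 : 5 ≤ p := by
    rcases Nat.lt_or_ge p 5 with hlt | hge
    · interval_cases p; exact absurd hp (by norm_num)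
    · exact hge
  have h0 : 8 * p + 1 ∣ 3 * (5 * (17)) := by norm_num; exact hd
  rcases (Nat.Prime.dvd_mul hq).mp h0 with h | h0
  · have := Nat.le_of_dvd (by norm_num) h
    omega
  rcases (Nat.Prime.dvd_mul hq).mp h0 with h | h0
  · have := Nat.le_of_dvd (by norm_num) h
    omega
  have h := h0
  have := Nat.le_of_dvd (by norm_num) h
  omega

/-- `8p + 1 ∤ 16777215` for a prime `p > 3` with `8p + 1` prime (`16777215 = 3·3·5·7·13·17·241`). [cite: Ribenboim1999FLTAmateurs, Ch. IV (1E) (proof)] -/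
theorem not_dvd_powself_8 {p : ℕ} (hp : p.Prime) (h3 : 3 < p) (hq : (8 * p + 1).Prime) :
    ¬ 8 * p + 1 ∣ 16777215 := by
  intro hd
  have h5 : 5 ≤ p := by
    rcases Nat.lt_or_ge p 5 with hlt | hge
    · interval_cases p; exact absurd hp (by norm_num)
    · exact hge
  have h0 : 8 * p + 1 ∣ 3 * (3 * (5 * (7 * (13 * (17 * (241)))))) := by norm_num; exact hd
  rcases (Nat.Prime.dvd_mul hq).mp h0 with h | h0
  · have := Nat.le_of_dvd (by norm_num) h
    omega
  rcases (Nat.Prime.dvd_mul hq).mp h0 with h | h0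
  · have := Nat.le_of_dvd (by norm_num) h
    omega
  rcases (Nat.Prime.dvd_mul hq).mp h0 with h | h0
  · have := Nat.le_of_dvd (by norm_num) h
    omega
  rcases (Nat.Prime.dvd_mul hq).mp h0 with h | h0
  · have := Nat.le_of_dvd (by norm_num) h
    omega
  rcases (Nat.Prime.dvd_mul hq).mp h0 with h | h0
  · have := Nat.le_of_dvd (by norm_num) h
    omega
  rcases (Nat.Prime.dvd_mul hq).mp h0 with h | h0
  · have := Nat.le_of_dvd (by norm_num) h
    omega
  have h := h0
  have e := (Nat.prime_dvd_prime_iff_eq hq (by norm_num)).mp h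
  have hp' : p = 30 := by omega
  rw [hp'] at hp
  exact absurd hp (by norm_num)

/-- **Legendre (1823), the case `q = 8p + 1`:** if `p > 3` and `8p + 1` are prime, the first case
of FLT holds for `p` — Wendt's criterion with `k = 8`: the resultant certificate
`A·(X^8 − 1) + B·((X+1)^8 − 1) = 255` and `8^8 − 1 = 16777215` have no prime factor of the form
`8p + 1`, `p > 3` prime. [cite: Ribenboim1999FLTAmateurs, Ch. IV (1E)] -/
theorem firstCase_of_prime_8p1 {p : ℕ} (hp : p.Prime) (h3 : 3 < p) (hq : (8 * p + 1).Prime)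
    {x y z : ℤ} (h : x ^ p + y ^ p + z ^ p = 0) : (p : ℤ) ∣ x * y * z := by
  refine wendt_firstCase (k := 8) hp (by omega) hq ?_ ?_ h
  · intro u h1 h2
    have hR : ((255 : ℕ) : ZMod (8 * p + 1)) = 0 := by
      have e : (255 : ZMod (8 * p + 1)) = 0 := by
        linear_combination ((-255) + (-680) * u + (-1804) * u ^ 2 + (-3032) * u ^ 3 + (-2990) * u ^ 4 + (-1720) * u ^ 5 + (-540) * u ^ 6 + (-72) * u ^ 7) * h1 + ((-85) + (72) * u + (-36) * u ^ 2 + (-8) * u ^ 3 + (30) * u ^ 4 + (-8) * u ^ 5 + (-36) * u ^ 6 + (72) * u ^ 7) * h2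
      exact_mod_cast e
    rw [ZMod.natCast_eq_zero_iff] at hR
    exact not_dvd_res_8 hp h3 hq hR
  · intro hk1
    push_cast at hk1
    have hK : ((16777215 : ℕ) : ZMod (8 * p + 1)) = 0 := by
      have e : ((16777215 : ℕ) : ZMod (8 * p + 1)) = (8 : ZMod (8 * p + 1)) ^ 8 - 1 := by
        push_cast; ring
      rw [e, hk1, sub_self]
    rw [ZMod.natCast_eq_zero_iff] at hK
    exact not_dvd_powself_8 hp h3 hq hK

/-- `10p + 1 ∤ 1023` for a prime `p > 3` with `10p + 1` prime (`1023 = 3·11·31`). [cite: Ribenboim1999FLTAmateurs, Ch. IV (1E) (proof)] -/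
theorem not_dvd_res_10 {p : ℕ} (hp : p.Prime) (h3 : 3 < p) (hq : (10 * p + 1).Prime) :
    ¬ 10 * p + 1 ∣ 1023 := by
  intro hd
  have h5 : 5 ≤ p := by
    rcases Nat.lt_or_ge p 5 with hlt | hge
    · interval_cases p; exact absurd hp (by norm_num)
    · exact hge
  have h0 : 10 * p + 1 ∣ 3 * (11 * (31)) := by norm_num; exact hd
  rcases (Nat.Prime.dvd_mul hq).mp h0 with h | h0
  · have := Nat.le_of_dvd (by norm_num) h
    omega
  rcases (Nat.Prime.dvd_mul hq).mp h0 with h | h0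
  · have := Nat.le_of_dvd (by norm_num) h
    omega
  have h := h0
  have := Nat.le_of_dvd (by norm_num) h
  omega

/-- `10p + 1 ∤ 9999999999` for a prime `p > 3` with `10p + 1` prime (`9999999999 = 3·3·11·41·271·9091`). [cite: Ribenboim1999FLTAmateurs, Ch. IV (1E) (proof)] -/
theorem not_dvd_powself_10 {p : ℕ} (hp : p.Prime) (h3 : 3 < p) (hq : (10 * p + 1).Prime) :
    ¬ 10 * p + 1 ∣ 9999999999 := by
  intro hd
  have h5 : 5 ≤ p := by
    rcases Nat.lt_or_ge p 5 with hlt | hge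
    · interval_cases p; exact absurd hp (by norm_num)
    · exact hge
  have h0 : 10 * p + 1 ∣ 3 * (3 * (11 * (41 * (271 * (9091))))) := by norm_num; exact hd
  rcases (Nat.Prime.dvd_mul hq).mp h0 with h | h0
  · have := Nat.le_of_dvd (by norm_num) h
    omega
  rcases (Nat.Prime.dvd_mul hq).mp h0 with h | h0
  · have := Nat.le_of_dvd (by norm_num) h
    omega
  rcases (Nat.Prime.dvd_mul hq).mp h0 with h | h0
  · have := Nat.le_of_dvd (by norm_num) h
    omega
  rcases (Nat.Prime.dvd_mul hq).mp h0 with h | h0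
  · have := Nat.le_of_dvd (by norm_num) h
    omega
  rcases (Nat.Prime.dvd_mul hq).mp h0 with h | h0
  · have e := (Nat.prime_dvd_prime_iff_eq hq (by norm_num)).mp h
    have hp' : p = 27 := by omega
    rw [hp'] at hp
    exact absurd hp (by norm_num)
  have h := h0
  have e := (Nat.prime_dvd_prime_iff_eq hq (by norm_num)).mp h
  have hp' : p = 909 := by omega
  rw [hp'] at hp
  exact absurd hp (by norm_num)

/-- **Legendre (1823), the case `q = 10p + 1`:** if `p > 3` and `10p + 1` are prime, the first case
of FLT holds for `p` — Wendt's criterion with `k = 10`: the resultant certificate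
`A·(X^10 − 1) + B·((X+1)^10 − 1) = 1023` and `10^10 − 1 = 9999999999` have no prime factor of the form
`10p + 1`, `p > 3` prime. [cite: Ribenboim1999FLTAmateurs, Ch. IV (1E)] -/
theorem firstCase_of_prime_10p1 {p : ℕ} (hp : p.Prime) (h3 : 3 < p) (hq : (10 * p + 1).Prime)
    {x y z : ℤ} (h : x ^ p + y ^ p + z ^ p = 0) : (p : ℤ) ∣ x * y * z := by
  refine wendt_firstCase (k := 10) hp (by omega) hq ?_ ?_ h
  · intro u h1 h2
    have hR : ((1023 : ℕ) : ZMod (10 * p + 1)) = 0 := by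
      have e : (1023 : ZMod (10 * p + 1)) = 0 := by
        linear_combination ((-1023) + (-3410) * u + (-12545) * u ^ 2 + (-29720) * u ^ 3 + (-44210) * u ^ 4 + (-42932) * u ^ 5 + (-27455) * u ^ 6 + (-11210) * u ^ 7 + (-2660) * u ^ 8 + (-280) * u ^ 9) * h1 + ((-341) + (280) * u + (-140) * u ^ 2 + (10) * u ^ 3 + (55) * u ^ 4 + (-68) * u ^ 5 + (55) * u ^ 6 + (10) * u ^ 7 + (-140) * u ^ 8 + (280) * u ^ 9) * h2
      exact_mod_cast e
    rw [ZMod.natCast_eq_zero_iff] at hR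
    exact not_dvd_res_10 hp h3 hq hR
  · intro hk1
    push_cast at hk1
    have hK : ((9999999999 : ℕ) : ZMod (10 * p + 1)) = 0 := by
      have e : ((9999999999 : ℕ) : ZMod (10 * p + 1)) = (10 : ZMod (10 * p + 1)) ^ 10 - 1 := by
        push_cast; ring
      rw [e, hk1, sub_self]
    rw [ZMod.natCast_eq_zero_iff] at hK
    exact not_dvd_powself_10 hp h3 hq hK

/-- `14p + 1 ∤ 3800856` for a prime `p > 3` with `14p + 1` prime (`3800856 = 2·2·2·3·29·43·127`). [cite: Ribenboim1999FLTAmateurs, Ch. IV (1E) (proof)] -/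
theorem not_dvd_res_14 {p : ℕ} (hp : p.Prime) (h3 : 3 < p) (hq : (14 * p + 1).Prime) :
    ¬ 14 * p + 1 ∣ 3800856 := by
  intro hd
  have h5 : 5 ≤ p := by
    rcases Nat.lt_or_ge p 5 with hlt | hge
    · interval_cases p; exact absurd hp (by norm_num)
    · exact hge
  have h0 : 14 * p + 1 ∣ 2 * (2 * (2 * (3 * (29 * (43 * (127)))))) := by norm_num; exact hd
  rcases (Nat.Prime.dvd_mul hq).mp h0 with h | h0
  · have := Nat.le_of_dvd (by norm_num) h
    omega
  rcases (Nat.Prime.dvd_mul hq).mp h0 with h | h0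
  · have := Nat.le_of_dvd (by norm_num) h
    omega
  rcases (Nat.Prime.dvd_mul hq).mp h0 with h | h0
  · have := Nat.le_of_dvd (by norm_num) h
    omega
  rcases (Nat.Prime.dvd_mul hq).mp h0 with h | h0
  · have := Nat.le_of_dvd (by norm_num) h
    omega
  rcases (Nat.Prime.dvd_mul hq).mp h0 with h | h0
  · have := Nat.le_of_dvd (by norm_num) h
    omega
  rcases (Nat.Prime.dvd_mul hq).mp h0 with h | h0
  · have := Nat.le_of_dvd (by norm_num) h
    omega
  have h := h0
  have e := (Nat.prime_dvd_prime_iff_eq hq (by norm_num)).mp h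
  have hp' : p = 9 := by omega
  rw [hp'] at hp
  exact absurd hp (by norm_num)

/-- `14p + 1 ∤ 11112006825558015` for a prime `p > 3` with `14p + 1` prime (`11112006825558015 = 3·5·13·7027567·8108731`). [cite: Ribenboim1999FLTAmateurs, Ch. IV (1E) (proof)] -/
theorem not_dvd_powself_14 {p : ℕ} (hp : p.Prime) (h3 : 3 < p) (hq : (14 * p + 1).Prime) :
    ¬ 14 * p + 1 ∣ 11112006825558015 := by
  intro hd
  have h5 : 5 ≤ p := by
    rcases Nat.lt_or_ge p 5 with hlt | hge
    · interval_cases p; exact absurd hp (by norm_num)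
    · exact hge
  have h0 : 14 * p + 1 ∣ 3 * (5 * (13 * (7027567 * (8108731)))) := by norm_num; exact hd
  rcases (Nat.Prime.dvd_mul hq).mp h0 with h | h0
  · have := Nat.le_of_dvd (by norm_num) h
    omega
  rcases (Nat.Prime.dvd_mul hq).mp h0 with h | h0
  · have := Nat.le_of_dvd (by norm_num) h
    omega
  rcases (Nat.Prime.dvd_mul hq).mp h0 with h | h0
  · have := Nat.le_of_dvd (by norm_num) h
    omega
  rcases (Nat.Prime.dvd_mul hq).mp h0 with h | h0
  · have e := (Nat.prime_dvd_prime_iff_eq hq (by norm_num)).mp h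
    have hp' : p = 501969 := by omega
    rw [hp'] at hp
    exact absurd hp (by norm_num)
  have h := h0
  have e := (Nat.prime_dvd_prime_iff_eq hq (by norm_num)).mp h
  have hp' : p = 579195 := by omega
  rw [hp'] at hp
  exact absurd hp (by norm_num)

/-- **Legendre (1823), the case `q = 14p + 1`:** if `p > 3` and `14p + 1` are prime, the first case
of FLT holds for `p` — Wendt's criterion with `k = 14`: the resultant certificate
`A·(X^14 − 1) + B·((X+1)^14 − 1) = 3800856` and `14^14 − 1 = 11112006825558015` have no prime factor of the form
`14p + 1`, `p > 3` prime. [cite: Ribenboim1999FLTAmateurs, Ch. IV (1E)] -/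
theorem firstCase_of_prime_14p1 {p : ℕ} (hp : p.Prime) (h3 : 3 < p) (hq : (14 * p + 1).Prime)
    {x y z : ℤ} (h : x ^ p + y ^ p + z ^ p = 0) : (p : ℤ) ∣ x * y * z := by
  refine wendt_firstCase (k := 14) hp (by omega) hq ?_ ?_ h
  · intro u h1 h2
    have hR : ((3800856 : ℕ) : ZMod (14 * p + 1)) = 0 := by
      have e : (3800856 : ZMod (14 * p + 1)) = 0 := by
        linear_combination ((-3800856) + (-17737328) * u + (-100558332) * u ^ 2 + (-372764728) * u ^ 3 + (-933310077) * u ^ 4 + (-1672280029) * u ^ 5 + (-2208042718) * u ^ 6 + (-2174206162) * u ^ 7 + (-1596528808) * u ^ 8 + (-863960342) * u ^ 9 + (-335203750) * u ^ 10 + (-88384625) * u ^ 11 + (-14208075) * u ^ 12 + (-1052450) * u ^ 13) * h1 + ((-1266952) + (1052450) * u + (-526225) * u ^ 2 + (-21175) * u ^ 3 + (294875) * u ^ 4 + (-197533) * u ^ 5 + (-85330) * u ^ 6 + (233060) * u ^ 7 + (-85330) * u ^ 8 + (-197533) * u ^ 9 + (294875) * u ^ 10 + (-21175) * u ^ 11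 + (-526225) * u ^ 12 + (1052450) * u ^ 13) * h2
      exact_mod_cast e
    rw [ZMod.natCast_eq_zero_iff] at hR
    exact not_dvd_res_14 hp h3 hq hR
  · intro hk1
    push_cast at hk1
    have hK : ((11112006825558015 : ℕ) : ZMod (14 * p + 1)) = 0 := by
      have e : ((11112006825558015 : ℕ) : ZMod (14 * p + 1)) = (14 : ZMod (14 * p + 1)) ^ 14 - 1 := by
        push_cast; ring
      rw [e, hk1, sub_self]
    rw [ZMod.natCast_eq_zero_iff] at hK
    exact not_dvd_powself_14 hp h3 hq hK

/-- `16p + 1 ∤ 458745` for a prime `p > 3` with `16p + 1` prime (`458745 = 3·5·7·17·257`). [cite: Ribenboim1999FLTAmateurs, Ch. IV (1E) (proof)] -/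
theorem not_dvd_res_16 {p : ℕ} (hp : p.Prime) (h3 : 3 < p) (hq : (16 * p + 1).Prime) :
    ¬ 16 * p + 1 ∣ 458745 := by
  intro hd
  have h5 : 5 ≤ p := by
    rcases Nat.lt_or_ge p 5 with hlt | hge
    · interval_cases p; exact absurd hp (by norm_num)
    · exact hge
  have h0 : 16 * p + 1 ∣ 3 * (5 * (7 * (17 * (257)))) := by norm_num; exact hd
  rcases (Nat.Prime.dvd_mul hq).mp h0 with h | h0
  · have := Nat.le_of_dvd (by norm_num) h
    omega
  rcases (Nat.Prime.dvd_mul hq).mp h0 with h | h0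
  · have := Nat.le_of_dvd (by norm_num) h
    omega
  rcases (Nat.Prime.dvd_mul hq).mp h0 with h | h0
  · have := Nat.le_of_dvd (by norm_num) h
    omega
  rcases (Nat.Prime.dvd_mul hq).mp h0 with h | h0
  · have := Nat.le_of_dvd (by norm_num) h
    omega
  have h := h0
  have e := (Nat.prime_dvd_prime_iff_eq hq (by norm_num)).mp h
  have hp' : p = 16 := by omega
  rw [hp'] at hp
  exact absurd hp (by norm_num)

/-- `16p + 1 ∤ 18446744073709551615` for a prime `p > 3` with `16p + 1` prime (`18446744073709551615 = 3·5·17·257·641·65537·6700417`). [cite: Ribenboim1999FLTAmateurs, Ch. IV (1E) (proof)] -/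
theorem not_dvd_powself_16 {p : ℕ} (hp : p.Prime) (h3 : 3 < p) (hq : (16 * p + 1).Prime) :
    ¬ 16 * p + 1 ∣ 18446744073709551615 := by
  intro hd
  have h5 : 5 ≤ p := by
    rcases Nat.lt_or_ge p 5 with hlt | hge
    · interval_cases p; exact absurd hp (by norm_num)
    · exact hge
  have h0 : 16 * p + 1 ∣ 3 * (5 * (17 * (257 * (641 * (65537 * (6700417)))))) := by norm_num; exact hd
  rcases (Nat.Prime.dvd_mul hq).mp h0 with h | h0
  · have := Nat.le_of_dvd (by norm_num) h
    omega
  rcases (Nat.Prime.dvd_mul hq).mp h0 with h | h0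
  · have := Nat.le_of_dvd (by norm_num) h
    omega
  rcases (Nat.Prime.dvd_mul hq).mp h0 with h | h0
  · have := Nat.le_of_dvd (by norm_num) h
    omega
  rcases (Nat.Prime.dvd_mul hq).mp h0 with h | h0
  · have e := (Nat.prime_dvd_prime_iff_eq hq (by norm_num)).mp h
    have hp' : p = 16 := by omega
    rw [hp'] at hp
    exact absurd hp (by norm_num)
  rcases (Nat.Prime.dvd_mul hq).mp h0 with h | h0
  · have e := (Nat.prime_dvd_prime_iff_eq hq (by norm_num)).mp h
    have hp' : p = 40 := by omega
    rw [hp'] at hp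
    exact absurd hp (by norm_num)
  rcases (Nat.Prime.dvd_mul hq).mp h0 with h | h0
  · have e := (Nat.prime_dvd_prime_iff_eq hq (by norm_num)).mp h
    have hp' : p = 4096 := by omega
    rw [hp'] at hp
    exact absurd hp (by norm_num)
  have h := h0
  have e := (Nat.prime_dvd_prime_iff_eq hq (by norm_num)).mp h
  have hp' : p = 418776 := by omega
  rw [hp'] at hp
  exact absurd hp (by norm_num)

/-- **Legendre (1823), the case `q = 16p + 1`:** if `p > 3` and `16p + 1` are prime, the first case
of FLT holds for `p` — Wendt's criterion with `k = 16`: the resultant certificate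
`A·(X^16 − 1) + B·((X+1)^16 − 1) = 458745` and `16^16 − 1 = 18446744073709551615` have no prime factor of the form
`16p + 1`, `p > 3` prime. [cite: Ribenboim1999FLTAmateurs, Ch. IV (1E)] -/
theorem firstCase_of_prime_16p1 {p : ℕ} (hp : p.Prime) (h3 : 3 < p) (hq : (16 * p + 1).Prime)
    {x y z : ℤ} (h : x ^ p + y ^ p + z ^ p = 0) : (p : ℤ) ∣ x * y * z := by
  refine wendt_firstCase (k := 16) hp (by omega) hq ?_ ?_ h
  · intro u h1 h2
    have hR : ((458745 : ℕ) : ZMod (16 * p + 1)) = 0 := by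
      have e : (458745 : ZMod (16 * p + 1)) = 0 := by
        linear_combination ((-458745) + (-2446640) * u + (-16330728) * u ^ 2 + (-71498896) * u ^ 3 + (-215189588) * u ^ 4 + (-472974000) * u ^ 5 + (-784335512) * u ^ 6 + (-998581648) * u ^ 7 + (-983997890) * u ^ 8 + (-750779344) * u ^ 9 + (-440213112) * u ^ 10 + (-194932592) * u ^ 11 + (-63145412) * u ^ 12 + (-14134736) * u ^ 13 + (-1955976) * u ^ 14 + (-126192) * u ^ 15) * h1 + ((-152915) + (126192) * u + (-63096) * u ^ 2 + (1232) * u ^ 3 + (29700) * u ^ 4 + (-26128) * u ^ 5 + (5304) * u ^ 6 + (13392) * u ^ 7 + (-20270) * u ^ 8 + (13392) * u ^ 9 + (5304) * u ^ 10 + (-26128) * u ^ 11 + (29700) * u ^ 12 + (1232) * u ^ 13 + (-63096) * u ^ 14 + (126192) * u ^ 15) * h2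
      exact_mod_cast e
    rw [ZMod.natCast_eq_zero_iff] at hR
    exact not_dvd_res_16 hp h3 hq hR
  · intro hk1
    push_cast at hk1
    have hK : ((18446744073709551615 : ℕ) : ZMod (16 * p + 1)) = 0 := by
      have e : ((18446744073709551615 : ℕ) : ZMod (16 * p + 1)) = (16 : ZMod (16 * p + 1)) ^ 16 - 1 := by
        push_cast; ring
      rw [e, hk1, sub_self]
    rw [ZMod.natCast_eq_zero_iff] at hK
    exact not_dvd_powself_16 hp h3 hq hK

end Legendre

open Legendre in
/-- **Legendre (1823) [Ribenboim, Ch. IV (1E)].** If `p > 3` is prime and one of `4p + 1`, `8p + 1`,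
`10p + 1`, `14p + 1`, `16p + 1` is prime, then the first case of Fermat's Last Theorem holds for `p`:
`x^p + y^p + z^p = 0` in integers implies `p ∣ xyz`. [cite: Ribenboim1999FLTAmateurs, Ch. IV (1E)] -/
theorem legendre_firstCase {p k : ℕ} (hp : p.Prime) (h3 : 3 < p)
    (hk : k = 4 ∨ k = 8 ∨ k = 10 ∨ k = 14 ∨ k = 16) (hq : (k * p + 1).Prime)
    {x y z : ℤ} (h : x ^ p + y ^ p + z ^ p = 0) : (p : ℤ) ∣ x * y * z := by
  rcases hk with rfl | rfl | rfl | rfl | rfl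
  · exact firstCase_of_prime_4p1 hp h3 hq h
  · exact firstCase_of_prime_8p1 hp h3 hq h
  · exact firstCase_of_prime_10p1 hp h3 hq h
  · exact firstCase_of_prime_14p1 hp h3 hq h
  · exact firstCase_of_prime_16p1 hp h3 hq h

end Literature.NumberTheory.DiophantineGeometry
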